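import Summits.CriticalPhenomena.Ising3DConformalLimit.Theorems.HyperoctahedralRPExistsScaleCovariantLimitUniformRegularityOfPinnedLimit
import Summits.CriticalPhenomena.Ising3DConformalLimit.Theorems.HyperoctahedralRPExistsScaleCovariantLimitNonSeparableModulusOfUniformRegularity
import Summits.CriticalPhenomena.Ising3DConformalLimit.Theorems.HyperoctahedralRPExistsScaleCovariantLimitCompactnessItemMapsDoubling
import Summits.CriticalPhenomena.Ising3DConformalLimit.Theses.MonotoneBlocking
import HarnessLib

/-!
# `NonSeparableModulus` (stmt-CriticalPhenomena-6152) is necessary for the summit, and its separability restriction is idle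

Negative knowledge about the crux `…Theses.MonotoneBlocking.NonSeparableModulus` (NS; the same
proposition as `…Theses.MirrorHoelderCompactness.NonSeparableModulus`), standing crux disprover
(D-0016); THEOREM-ONLY (no definitions), supports the item, closes nothing. Split of §4 of the work file
`Summits/CriticalPhenomena/Ising3DConformalLimit/Cruxes/NonSeparableModulus/Disproof.lean`.

* `not_summit_of_not_nonSeparableModulus : ¬NS → ¬Ising3DConformalLimit` — a refutation of this crux
  refutes the sub-problem: the conjunct's non-degenerate pointwise limit is re-pinned along the full
  filter (`hasPointwiseScalingLimit_rhoPin`), gives `UniformRegularity`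
  (`stub_uniformRegularity_of_pinnedLimit`) and then NS (`stub_nonSeparableModulus_of_uniformRegularity`).
  So no counterexample to NS is compatible with the conjecture; the disprover's search space is
  exactly "the critical `ℤ³` two-point function fails axial doubling" (next item).
* `doubling_fails_of_not_nonSeparableModulus` — `¬NS` forces, for every `κ > 0`, a scale `n ≥ 1` with
  `⟨σ₀σ_{2ne₀}⟩ < κ⟨σ₀σ_{ne₀}⟩` (contrapositive of the landed chain 6150 ⟹ 4658 ⟹ 6152); with the
  crux-directory theorem `AxialPincer.twoPointDoubling_of_nonSeparableModulus` this is an equivalence.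
* `onePointModulus_of_twoPointDoubling` — the hypothesis "`(x,i)` not `m`-separable" is NOT
  load-bearing: the restriction-free one-point modulus (written out; it trivially implies NS) already
  follows from item 6150 through `UniformRegularity` (b) on a compact thickening;
  `not_summit_of_not_onePointModulus`: and it, too, is necessary for the conjunct.

References: Aizenman–Duminil-Copin 2021 Rem. 5.10 (doubling open) [AizenmanDuminilCopinAnnals2021];
Duminil-Copin ICM 2022 §8.4 [DuminilCopinICM2022].
-/

noncomputable section

namespace Summit.CriticalPhenomena.Ising3DConformalLimit.NonSeparableModulusNegative

open Literature.Probability.LatticeModels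
open Summit.CriticalPhenomena.Ising3DConformalLimit.Theses
open Summit.CriticalPhenomena.Ising3DConformalLimit.Cruxes.ExistsScaleCovariantLimit.TwoHierarchies
open Summit.CriticalPhenomena.Ising3DConformalLimit.ExistsScaleCovariantLimitNegative
  (hasPointwiseScalingLimit_rhoPin)

/-- **A refutation of NS refutes the conjunct `Ising3DConformalLimit`** (Summit ⟹ pinned full-filter
limit ⟹ `UniformRegularity` ⟹ NS, all landed). [folklore] -/
theorem not_summit_of_not_nonSeparableModulus (h : ¬ MonotoneBlocking.NonSeparableModulus) :
    ¬ _root_.Ising3DConformalLimit := by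
  rintro ⟨ρ, Δ, S, hρ, -, hlim, hnd, -, -⟩
  exact h (stub_nonSeparableModulus_of_uniformRegularity
    (stub_uniformRegularity_of_pinnedLimit ⟨_, hasPointwiseScalingLimit_rhoPin hρ hlim hnd⟩))

/-- The same for the `MirrorHoelderCompactness` copy of the crux. [folklore] -/
theorem not_summit_of_not_mirror_nonSeparableModulus
    (h : ¬ MirrorHoelderCompactness.NonSeparableModulus) : ¬ _root_.Ising3DConformalLimit :=
  not_summit_of_not_nonSeparableModulus h

/-- **`¬NS` forces a failure of all-scale axial doubling** (item 6150): for every `κ > 0` some `n ≥ 1`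
with `⟨σ₀σ_{2ne₀}⟩_{β_c} < κ ⟨σ₀σ_{ne₀}⟩_{β_c}` (contrapositive of the landed 6150 ⟹ 4658 ⟹ 6152).
[cite: AizenmanDuminilCopinAnnals2021, Remark 5.10] -/
theorem doubling_fails_of_not_nonSeparableModulus (h : ¬ MonotoneBlocking.NonSeparableModulus) :
    ∀ κ : ℝ, 0 < κ → ∃ n : ℕ, 1 ≤ n ∧
      criticalTwoPoint 3 (Pi.single 0 (2 * (n : ℤ))) < κ * criticalTwoPoint 3 (Pi.single 0 (n : ℤ)) := by
  intro κ hκ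
  by_contra hall
  push Not at hall
  exact h (stub_nonSeparableModulus_of_uniformRegularity
    (ItemMaps.uniformRegularity_of_doubling ⟨κ, hκ, hall⟩))

/-- **The one-point modulus WITHOUT the non-separability restriction** (NS with the hypothesis
"`(x, i)` not `m`-separable" deleted; it trivially implies NS, with any `m`) already follows from
`UniformRegularity` (item 4658): clause (b) on a compact closed thickening of `K` inside
`NonCoincident` — the landed stub's argument, which never looked at separability. [folklore] -/
theorem onePointModulus_of_uniformRegularity
    (hUR : MirrorHoelderCompactness.UniformRegularity) :
    (∀ (n : ℕ) (K : Set (Fin n → EuclideanSpace ℝ (Fin 3))), K ⊆ NonCoincident 3 n → IsCompact K →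
      ∀ ε : ℝ, 0 < ε → ∃ η δ₀ : ℝ, 0 < η ∧ 0 < δ₀ ∧ ∀ δ ∈ Set.Ioo 0 δ₀, ∀ x ∈ K,
      ∀ (i : Fin n) (y : EuclideanSpace ℝ (Fin 3)), ‖y - x i‖ < η →
        |rescaledCorrelator (criticalCorr 3)
            (fun δ : ℝ => (criticalTwoPoint 3 (Pi.single 0 ⌊δ⁻¹⌋)) ^ (-(1/2:ℝ))) n δ
            (Function.update x i y) -
          rescaledCorrelator (criticalCorr 3)
            (fun δ : ℝ => (criticalTwoPoint 3 (Pi.single 0 ⌊δ⁻¹⌋)) ^ (-(1/2:ℝ))) n δ x| < ε) := by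
  intro n K hKs hK ε hε
  obtain ⟨η₀, hη₀, hK'c, hK's⟩ := exists_compact_cthickening_subset_nonCoincident hKs hK
  obtain ⟨r, δ₀, hr, hδ₀, hb⟩ := (hUR.1 n (Metric.cthickening η₀ K) hK's hK'c).2 ε hε
  refine ⟨min η₀ r, δ₀, lt_min hη₀ hr, hδ₀, fun δ hδ x hx i y hy => ?_⟩
  have hd : dist (Function.update x i y) x ≤ ‖y - x i‖ := dist_update_le_norm_sub x i y
  have hmem : Function.update x i y ∈ Metric.cthickening η₀ K :=
    Metric.mem_cthickening_of_dist_le _ x _ K hx (hd.trans (hy.le.trans (min_le_left _ _)))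
  have hxK' : x ∈ Metric.cthickening η₀ K := Metric.self_subset_cthickening K hx
  exact hb δ hδ _ hmem x hxK' (hd.trans_lt (hy.trans_le (min_le_right _ _)))

/-- **The separability restriction is idle given item 6150**: doubling alone yields the
restriction-free one-point modulus (so, with `AxialPincer`, NS ↔ restriction-free NS ↔ 6150).
[folklore] -/
theorem onePointModulus_of_twoPointDoubling (hD : MirrorHoelderCompactness.TwoPointDoubling) :
    (∀ (n : ℕ) (K : Set (Fin n → EuclideanSpace ℝ (Fin 3))), K ⊆ NonCoincident 3 n → IsCompact K →
      ∀ ε : ℝ, 0 < ε → ∃ η δ₀ : ℝ, 0 < η ∧ 0 < δ₀ ∧ ∀ δ ∈ Set.Ioo 0 δ₀, ∀ x ∈ K,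
      ∀ (i : Fin n) (y : EuclideanSpace ℝ (Fin 3)), ‖y - x i‖ < η →
        |rescaledCorrelator (criticalCorr 3)
            (fun δ : ℝ => (criticalTwoPoint 3 (Pi.single 0 ⌊δ⁻¹⌋)) ^ (-(1/2:ℝ))) n δ
            (Function.update x i y) -
          rescaledCorrelator (criticalCorr 3)
            (fun δ : ℝ => (criticalTwoPoint 3 (Pi.single 0 ⌊δ⁻¹⌋)) ^ (-(1/2:ℝ))) n δ x| < ε) :=
  onePointModulus_of_uniformRegularity (ItemMaps.uniformRegularity_of_doubling hD)

/-- Even the restriction-free one-point modulus is necessary for the conjunct (through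
`UniformRegularity` of the pinned limit): its failure would refute `Ising3DConformalLimit` too.
[folklore] -/
theorem not_summit_of_not_onePointModulus (h : ¬ (∀ (n : ℕ) (K : Set (Fin n → EuclideanSpace ℝ (Fin 3))), K ⊆ NonCoincident 3 n → IsCompact K →
      ∀ ε : ℝ, 0 < ε → ∃ η δ₀ : ℝ, 0 < η ∧ 0 < δ₀ ∧ ∀ δ ∈ Set.Ioo 0 δ₀, ∀ x ∈ K,
      ∀ (i : Fin n) (y : EuclideanSpace ℝ (Fin 3)), ‖y - x i‖ < η →
        |rescaledCorrelator (criticalCorr 3)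
            (fun δ : ℝ => (criticalTwoPoint 3 (Pi.single 0 ⌊δ⁻¹⌋)) ^ (-(1/2:ℝ))) n δ
            (Function.update x i y) -
          rescaledCorrelator (criticalCorr 3)
            (fun δ : ℝ => (criticalTwoPoint 3 (Pi.single 0 ⌊δ⁻¹⌋)) ^ (-(1/2:ℝ))) n δ x| < ε)) :
    ¬ _root_.Ising3DConformalLimit := by
  rintro ⟨ρ, Δ, S, hρ, -, hlim, hnd, -, -⟩
  exact h (onePointModulus_of_uniformRegularity
    (stub_uniformRegularity_of_pinnedLimit ⟨_, hasPointwiseScalingLimit_rhoPin hρ hlim hnd⟩))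

end Summit.CriticalPhenomena.Ising3DConformalLimit.NonSeparableModulusNegative

end
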